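import Summits.QuantumFields.YangMills.Theorems.BalabanUVNodesN09DomAltThresholdNull
import Literature.MathematicalPhysics.QuantumFieldTheory.Balaban1983to89.Node00.Record12ContTResidue
import Literature.MathematicalPhysics.QuantumFieldTheory.Balaban1983to89.Node00.CanonicalTransportOfRecord

/-!
# NODE N09 · (F3) OF THE P7 LOCATOR AUDIT — THE a.e. EDITION: A RENORMALISATION TRANSFORM (`Setup.IsRT`) OF A NON-NEGATIVE INTEGRABLE DENSITY IS POSITIVE AT THE
# BLOCK AVERAGE OF `dU`-ALMOST EVERY FINE FIELD AT WHICH THE DENSITY IS POSITIVE; at the record: `(T_kρ)(Ū) > 0` for `dU`-a.e. `U` with `ρ(U) > 0` — in particular for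
# `dU`-a.e. `U ∈ domAltOfRecord ν K k` when `ρ` is cut off sharply there — so `log T_kρ` is defined at `dŪ`-almost every image point of the small-field domain

Cell `pub-ymgap` (YM-PLAN Track A), DAG node N09 [Balaban1987RG1] (= [I]); seat `pub-ymgap-dag-n09-w1` g4; count-neutral helper keyed to K1⁷
`stmt-QuantumFields-20542` (`--kind proof --supports … --as helper`).  HONEST FRAMING: kernel measure theory at NODE 00's definitions; NOTHING of Bałaban's
analysis asserted; N09 NOT discharged; K0⁷∕K1⁷ NOT closed; counts unmoved; one finite 𝕋⁴ programme at fixed ε — R4 closes the conditional rung `BalabanLadder.UV`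
only; the Yang–Mills mass gap (Clay) is NOT proved by any of this; nothing continuum ∕ ℝ⁴ ∕ OS.

THE LOCATED DEBT.  `pub-ymgap-node00-def-K0e/P7-LOCATOR-AUDIT.md` §4 lists three standard-analysis inputs behind the β-version proviso (N09's analytic binder `hreg`):
(F1) the Jacobian face of (0.4), (F2) level-set nullity (this seat's `HaarEigenvalueSphereNull` ∕ `PlaquetteVariableHaarLaw` ∕ `…N09DomAltThresholdNull` ∕
`…N09FibreThresholdNullAE`), and **(F3) POSITIVITY of `T_{k−1}ρ_{k−1}` on `domAlt_k`** («the log-at-zero corner … follows from (F1) + «fibre(W) meets domAlt_{k−1}»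
(an N07-class existence statement) or from a (2.9) re-key»).  As for (F2), ONE part of (F3) is free — the almost-everywhere part — and this file proves exactly it,
for EVERY transform in the cell's sense `Setup.IsRT` (the push-forward reading `∫ (Tρ) f dV = ∫ ρ · f∘Ū dU` of [Balaban1985Averaging] (10)): testing `IsRT` with the
indicator of `{Tρ ≤ 0}` (measurable modification) shows `ρ · 𝟙{Tρ(Ū) ≤ 0} = 0` `dU`-a.e., and `HaarAC` transfers the modification back along `Ū`.  So the
transform of a non-negative integrable density is POSITIVE at `Ū` for `dU`-almost every `U` with `ρ(U) > 0` — equivalently on a set of coarse fields of FULL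
`(dU|_{ρ>0}).map Ū`-measure.  What is NOT free, and not here: positivity at EVERY `V ∈ domAlt_{k+1}` (needs every such fibre to meet `{ρ > 0}` with positive conditional
mass — the N07-class statement — and the continuity (F1)).

WHAT IS PROVED (theorems only; 0 def; 0 sorry; axioms standard).
* §1 GENERIC over `Setup` (`[GaugeGroup G] [MeasurableSpace G] [HaarData G]`, any `Params`, level, measurable `avg` with `HaarAC`): ★★ `pos_comp_avg_ae_of_isRT`
  (`IsRT avg ρ ρ'`, `0 ≤ ρ` integrable, `ρ'` integrable ⇒ `∀ᵐ U ∂dU, 0 < ρ U → 0 < ρ' (avg U)`), `ae_pos_comp_avg_of_isRT_of_pos` (`ρ > 0` everywhere ⇒ `ρ'(Ū) > 0` `dU`-a.e.).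
* §2 AT THE RECORD (`transportOfRecord`, `isRT_transportOfRecord`, `integrable_transportOfRecord`, `avOfRecord_haarAC`, `k < K`, BY NAME): ★★ `transportOfRecord_pos_comp_avg_ae`,
  `TrhoOfRecord_pos_comp_avg_ae` (the Radon–Nikodym transport of record `TrhoOfRecord`, same statement),
  ★★★ `transportOfRecord_indicator_mul_pos_ae_on_domAltOfRecord` (for `ρ > 0` integrable: `dU`-a.e. `U ∈ domAltOfRecord ν K k` has
  `0 < T_k(chiFixAltOfRecord·ρ)(Ū)`), `exp_log_transportOfRecord_comp_avg_ae` (there `Real.exp (Real.log (T_k(χρ)(Ū))) = T_k(χρ)(Ū)`).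
* §3 THE β-TRANSPORT OF RECORD `TcanOfRecord` (K0e's canonical-version transport, the β token of Record 13 by director-ym №128 D2 (i′); `isRT_TcanOfRecord`,
  `integrable_TcanOfRecord`, `TcanOfRecord_ae_eq`, `canonVersion_eqOn_congr_ae`, `regSet_congr_ae` BY NAME): ★★ `TcanOfRecord_pos_comp_avg_ae`,
  ★★★ `TcanOfRecord_indicator_mul_pos_ae_on_domAltOfRecord`.  (The companion reading of the sibling file `…N09FibreThresholdNullAE`'s sharp∕closed-cut congruence
  through the canonical version — equal maximal regular sets, equal canonical versions on them — is the sequel `…N09TransportCutoffBlind`.)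

HONEST SCOPE.  (i) a.e. in the FINE field `U` (equivalently: full measure for the image law of `dU|_{ρ>0}`), NOT at every coarse `V ∈ domAlt_{k+1}`; the everywhere
edition = (F1) + the N07-class fibre statement, untouched; hence `hreg`∕`contTOn` stay DISPLAYED.  (ii) `k < K` where `HaarAC` of record is used.  (iii) Nothing of
def-T ∕ K0e ∕ pub-balaban pv07 re-proved; `IsRT` is consumed as the cell typed it.
-/

noncomputable section

open MeasureTheory Set Filter Topology
open Literature.MathematicalPhysics.QuantumFieldTheory
open Literature.MathematicalPhysics.QuantumFieldTheory.Balaban1983to89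
open Literature.MathematicalPhysics.QuantumFieldTheory.Balaban1983to89.Node00
open Literature.MathematicalPhysics.QuantumFieldTheory.Balaban1983to89.T4Continuum (T4Family)
open Literature.MathematicalPhysics.QuantumFieldTheory.Balaban1983to89.T4FiniteEpsInhabited (HaarAC)

namespace Summit.QuantumFields.YangMills.BalabanUVNodes.N09TransportPositiveAE

/-! ## §1 Generic: an `IsRT` transform of a non-negative density is positive at `Ū` for `dU`-a.e. `U` in `{ρ > 0}` -/

section Generic

variable {P : Params} {j : ℕ} {G : Type*} [GaugeGroup G] [MeasurableSpace G] [HaarData G]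

/-- **★★ a.e. POSITIVITY OF A RENORMALISATION TRANSFORM ON THE IMAGE OF THE POSITIVITY SET**: if `ρ'` is a renormalisation transform of `ρ ≥ 0` along a measurable
averaging `avg` with `HaarAC` (`Setup.IsRT avg ρ ρ'`, both integrable), then for `dU`-almost every fine field `U` with `ρ U > 0` one has `ρ' (avg U) > 0`
(test `IsRT` with the indicator of `{g ≤ 0}`, `g` a measurable modification of `ρ'`; `HaarAC` moves the modification along `avg`).
[cite: Balaban1985Averaging, (10) p.19; Balaban1987RG1, (0.13) p.254] -/
theorem pos_comp_avg_ae_of_isRT {avg : GaugeField P j G → GaugeField P (j + 1) G} (havg : Measurable avg) (hac : HaarAC avg)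
    {ρ : Density P j G} {ρ' : Density P (j + 1) G} (hT : IsRT avg ρ ρ') (h0 : ∀ U, 0 ≤ ρ U)
    (hρ : Integrable ρ (fieldMeasure P j G)) (hρ' : Integrable ρ' (fieldMeasure P (j + 1) G)) :
    ∀ᵐ U ∂fieldMeasure P j G, 0 < ρ U → 0 < ρ' (avg U) := by
  -- a measurable modification `g` of `ρ'` and the test set `Z = {g ≤ 0}`
  set g : GaugeField P (j + 1) G → ℝ := hρ'.1.mk ρ' with hg
  have hgm : Measurable g := hρ'.1.stronglyMeasurable_mk.measurable
  have hae : ρ' =ᵐ[fieldMeasure P (j + 1) G] g := hρ'.1.ae_eq_mk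
  set Z : Set (GaugeField P (j + 1) G) := {V | g V ≤ 0} with hZ
  have hZm : MeasurableSet Z := measurableSet_le hgm measurable_const
  set f : GaugeField P (j + 1) G → ℝ := Z.indicator (fun _ => (1 : ℝ)) with hf
  have hfm : Measurable f := measurable_const.indicator hZm
  have hfb : ∀ V, |f V| ≤ 1 := fun V => by
    by_cases hV : V ∈ Z
    · rw [hf, Set.indicator_of_mem hV, abs_one]
    · rw [hf, Set.indicator_of_notMem hV, abs_zero]; exact zero_le_one
  have hf01 : ∀ V, 0 ≤ f V := fun V => by
    by_cases hV : V ∈ Z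
    · rw [hf, Set.indicator_of_mem hV]; exact zero_le_one
    · rw [hf, Set.indicator_of_notMem hV]
  -- the push-forward identity tested on `f`
  have key := hT f hfm ⟨1, hfb⟩
  -- LHS ≤ 0
  have hL : ∫ V, ρ' V * f V ∂fieldMeasure P (j + 1) G ≤ 0 := by
    have h1 : (fun V => ρ' V * f V) =ᵐ[fieldMeasure P (j + 1) G] fun V => g V * f V := hae.mul Filter.EventuallyEq.rfl
    rw [integral_congr_ae h1]
    refine integral_nonpos fun V => ?_
    by_cases hV : V ∈ Z
    · rw [hf, Set.indicator_of_mem hV, mul_one]; exact hV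
    · rw [hf, Set.indicator_of_notMem hV, mul_zero]; exact le_rfl
  -- RHS ≥ 0 pointwise, hence = 0, hence the integrand vanishes a.e.
  have hnn : ∀ U, 0 ≤ ρ U * f (avg U) := fun U => mul_nonneg (h0 U) (hf01 _)
  have hint : Integrable (fun U => ρ U * f (avg U)) (fieldMeasure P j G) :=
    hρ.mul_bdd (hfm.comp havg).aestronglyMeasurable
      (Filter.Eventually.of_forall fun U => by simpa [Real.norm_eq_abs] using hfb (avg U))
  have hR0 : ∫ U, ρ U * f (avg U) ∂fieldMeasure P j G = 0 :=
    le_antisymm (key ▸ hL) (integral_nonneg hnn)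
  have hzero : (fun U => ρ U * f (avg U)) =ᵐ[fieldMeasure P j G] 0 :=
    (integral_eq_zero_iff_of_nonneg_ae (Filter.Eventually.of_forall hnn) hint).1 hR0
  -- the modification moved along `avg` by `HaarAC`
  have htr : ∀ᵐ U ∂fieldMeasure P j G, ρ' (avg U) = g (avg U) :=
    ae_of_ae_map havg.aemeasurable (hac.ae_le hae)
  filter_upwards [hzero, htr] with U hU hUg hpos
  have hfU : f (avg U) = 0 := by
    rcases mul_eq_zero.1 hU with h | h
    · exact absurd h hpos.ne'
    · exact h
  have hnotZ : avg U ∉ Z := fun h => by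
    rw [hf, Set.indicator_of_mem h] at hfU; exact one_ne_zero hfU
  have hgpos : 0 < g (avg U) := not_le.1 hnotZ
  rwa [hUg]

/-- If `ρ > 0` everywhere: `ρ'(Ū) > 0` for `dU`-almost every `U`. [cite: Balaban1985Averaging, (10) p.19] -/
theorem ae_pos_comp_avg_of_isRT_of_pos {avg : GaugeField P j G → GaugeField P (j + 1) G} (havg : Measurable avg) (hac : HaarAC avg)
    {ρ : Density P j G} {ρ' : Density P (j + 1) G} (hT : IsRT avg ρ ρ') (h0 : ∀ U, 0 < ρ U)
    (hρ : Integrable ρ (fieldMeasure P j G)) (hρ' : Integrable ρ' (fieldMeasure P (j + 1) G)) :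
    ∀ᵐ U ∂fieldMeasure P j G, 0 < ρ' (avg U) := by
  filter_upwards [pos_comp_avg_ae_of_isRT havg hac hT (fun U => (h0 U).le) hρ hρ'] with U hU using hU (h0 U)

end Generic

/-! ## §2 At the record: the transform of record of a density cut off sharply on the small-field domain -/

section Record

variable (F : T4Family) (N : ℕ) [NeZero N]

/-- **★★ THE TRANSFORM OF RECORD IS POSITIVE AT `Ū` FOR `dU`-a.e. `U` WITH `ρ(U) > 0`** (`ρ ≥ 0` integrable, `k < K`; `transportOfRecord`,
`isRT_transportOfRecord`, `integrable_transportOfRecord`, `avOfRecord_haarAC` BY NAME). [cite: Balaban1988Convergent, (3.1) p.264; Balaban1985Averaging, (10) p.19] -/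
theorem transportOfRecord_pos_comp_avg_ae {K k : ℕ} (hk : k < K) (ρ : Density (F.P K) k (SU N)) (h0 : ∀ U, 0 ≤ ρ U)
    (hρ : Integrable ρ (fieldMeasure (F.P K) k (SU N))) :
    ∀ᵐ U ∂fieldMeasure (F.P K) k (SU N), 0 < ρ U → 0 < transportOfRecord F N K k ρ ((avOfRecord F N K k).avg U) :=
  pos_comp_avg_ae_of_isRT (avOfRecord_measurable F N K k) (avOfRecord_haarAC F N K k hk) (isRT_transportOfRecord F N K k hk ρ hρ) h0 hρ
    (integrable_transportOfRecord hk hρ)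

/-- The same for def-B12∕node00's Radon–Nikodym transport of record `TrhoOfRecord = rnTransport Ū` (`isRT_TrhoOfRecord`, `integrable_TrhoOfRecord` BY NAME): positive at `Ū`
for `dU`-a.e. `U` with `ρ(U) > 0` (`ρ ≥ 0` integrable, `k < K`). [cite: Balaban1985Averaging, (10) p.19] -/
theorem TrhoOfRecord_pos_comp_avg_ae {K k : ℕ} (hk : k < K) (ρ : Density (F.P K) k (SU N)) (h0 : ∀ U, 0 ≤ ρ U)
    (hρ : Integrable ρ (fieldMeasure (F.P K) k (SU N))) :
    ∀ᵐ U ∂fieldMeasure (F.P K) k (SU N), 0 < ρ U → 0 < TrhoOfRecord F N K k ρ ((avOfRecord F N K k).avg U) :=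
  pos_comp_avg_ae_of_isRT (avOfRecord_measurable F N K k) (avOfRecord_haarAC F N K k hk) (isRT_TrhoOfRecord F N K k hk ρ hρ) h0 hρ
    (integrable_TrhoOfRecord F N K k hk ρ hρ)

/-- The sharp cut-off `chiFixAltOfRecord · ρ` of a non-negative integrable density is non-negative and integrable. [cite: Balaban1987RG1, p.259 (bookkeeping)] -/
theorem integrable_chiFixAlt_mul (ν : Stage7Numerics) (K k : ℕ) {ρ : Density (F.P K) k (SU N)} (hρ : Integrable ρ (fieldMeasure (F.P K) k (SU N))) :
    Integrable (fun U => chiFixAltOfRecord F N ν K k U * ρ U) (fieldMeasure (F.P K) k (SU N)) := by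
  rw [chiFixAltOfRecord_eq_indicator]
  have h : (fun U => (domAltOfRecord F N ν K k).indicator (1 : GaugeField (F.P K) k (SU N) → ℝ) U * ρ U) =
      (domAltOfRecord F N ν K k).indicator ρ := by
    funext U
    by_cases hU : U ∈ domAltOfRecord F N ν K k
    · rw [Set.indicator_of_mem hU, Set.indicator_of_mem hU, Pi.one_apply, one_mul]
    · rw [Set.indicator_of_notMem hU, Set.indicator_of_notMem hU, zero_mul]
  rw [h]
  exact hρ.indicator (measurableSet_domAltOfRecord ν K k)

/-- **★★★ (F3), a.e. EDITION, AT THE RECORD'S SHARP CUT-OFF**: for a density `ρ > 0` integrable on the step-`k` fields and `k < K`, `dU`-almost every field `U` of the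
small-field domain `domAltOfRecord ν K k` has `0 < T_k(chiFixAltOfRecord·ρ)(Ū)` — the transform of record of the sharply cut density is positive at the block average
of almost every small field. [cite: Balaban1987RG1, p.259 and (0.13) p.254; Balaban1988Convergent, (3.1) p.264] -/
theorem transportOfRecord_indicator_mul_pos_ae_on_domAltOfRecord (ν : Stage7Numerics) {K k : ℕ} (hk : k < K) (ρ : Density (F.P K) k (SU N))
    (h0 : ∀ U, 0 < ρ U) (hρ : Integrable ρ (fieldMeasure (F.P K) k (SU N))) :
    ∀ᵐ U ∂fieldMeasure (F.P K) k (SU N), U ∈ domAltOfRecord F N ν K k →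
      0 < transportOfRecord F N K k (fun U => chiFixAltOfRecord F N ν K k U * ρ U) ((avOfRecord F N K k).avg U) := by
  have hnn : ∀ U, 0 ≤ chiFixAltOfRecord F N ν K k U * ρ U := fun U => by
    rcases chiFixAltOfRecord_eq_zero_or_one ν K k U with h | h
    · rw [h, zero_mul]
    · rw [h, one_mul]; exact (h0 U).le
  filter_upwards [transportOfRecord_pos_comp_avg_ae F N hk _ hnn (integrable_chiFixAlt_mul F N ν K k hρ)] with U hU hmem
  refine hU ?_
  rw [(chiFixAltOfRecord_eq_one_iff_mem ν K k U).2 hmem, one_mul]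
  exact h0 U

/-- Hence `log T_k(chiFixAltOfRecord·ρ)` is honestly defined (`exp ∘ log = id`) at `Ū` for `dU`-a.e. `U` of the small-field domain (`ρ > 0` integrable, `k < K`).
[cite: Balaban1987RG1, (0.13) p.254 and (0.22) p.256 (bookkeeping)] -/
theorem exp_log_transportOfRecord_comp_avg_ae (ν : Stage7Numerics) {K k : ℕ} (hk : k < K) (ρ : Density (F.P K) k (SU N))
    (h0 : ∀ U, 0 < ρ U) (hρ : Integrable ρ (fieldMeasure (F.P K) k (SU N))) :
    ∀ᵐ U ∂fieldMeasure (F.P K) k (SU N), U ∈ domAltOfRecord F N ν K k →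
      Real.exp (Real.log (transportOfRecord F N K k (fun U => chiFixAltOfRecord F N ν K k U * ρ U) ((avOfRecord F N K k).avg U))) =
        transportOfRecord F N K k (fun U => chiFixAltOfRecord F N ν K k U * ρ U) ((avOfRecord F N K k).avg U) := by
  filter_upwards [transportOfRecord_indicator_mul_pos_ae_on_domAltOfRecord F N ν hk ρ h0 hρ] with U hU hmem
  exact Real.exp_log (hU hmem)

end Record

/-! ## §3 The β-transport of record `TcanOfRecord` (canonical version): positivity a.e. -/

section Canonical

variable (F : T4Family) (N : ℕ) [NeZero N]

/-- **★★ THE β-TRANSPORT OF RECORD IS POSITIVE AT `Ū` FOR `dU`-a.e. `U` WITH `ρ(U) > 0`** (`TcanOfRecord`, `ρ ≥ 0` integrable, `k < K`; `isRT_TcanOfRecord` ∕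
`integrable_TcanOfRecord` BY NAME). [cite: Balaban1987RG1, (0.13) p.254 and (0.19) p.255; Balaban1985Averaging, (10) p.19] -/
theorem TcanOfRecord_pos_comp_avg_ae {K k : ℕ} (hk : k < K) (ρ : Density (F.P K) k (SU N)) (h0 : ∀ U, 0 ≤ ρ U)
    (hρ : Integrable ρ (fieldMeasure (F.P K) k (SU N))) :
    ∀ᵐ U ∂fieldMeasure (F.P K) k (SU N), 0 < ρ U → 0 < TcanOfRecord F N K k ρ ((avOfRecord F N K k).avg U) :=
  pos_comp_avg_ae_of_isRT (avOfRecord_measurable F N K k) (avOfRecord_haarAC F N K k hk) (isRT_TcanOfRecord hk hρ) h0 hρ (integrable_TcanOfRecord hk hρ)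

/-- **★★★ (F3), a.e. EDITION, FOR THE β-TRANSPORT OF RECORD**: for `ρ > 0` integrable and `k < K`, `dU`-almost every `U ∈ domAltOfRecord ν K k` has
`0 < TcanOfRecord K k (chiFixAltOfRecord·ρ) (Ū)`. [cite: Balaban1987RG1, p.259 and (0.19) p.255; Balaban1988Convergent, (3.1) p.264] -/
theorem TcanOfRecord_indicator_mul_pos_ae_on_domAltOfRecord (ν : Stage7Numerics) {K k : ℕ} (hk : k < K) (ρ : Density (F.P K) k (SU N))
    (h0 : ∀ U, 0 < ρ U) (hρ : Integrable ρ (fieldMeasure (F.P K) k (SU N))) :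
    ∀ᵐ U ∂fieldMeasure (F.P K) k (SU N), U ∈ domAltOfRecord F N ν K k →
      0 < TcanOfRecord F N K k (fun U => chiFixAltOfRecord F N ν K k U * ρ U) ((avOfRecord F N K k).avg U) := by
  have hnn : ∀ U, 0 ≤ chiFixAltOfRecord F N ν K k U * ρ U := fun U => by
    rcases chiFixAltOfRecord_eq_zero_or_one ν K k U with h | h
    · rw [h, zero_mul]
    · rw [h, one_mul]; exact (h0 U).le
  filter_upwards [TcanOfRecord_pos_comp_avg_ae F N hk _ hnn (integrable_chiFixAlt_mul F N ν K k hρ)] with U hU hmem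
  refine hU ?_
  rw [(chiFixAltOfRecord_eq_one_iff_mem ν K k U).2 hmem, one_mul]
  exact h0 U

end Canonical

end Summit.QuantumFields.YangMills.BalabanUVNodes.N09TransportPositiveAE

end
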